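import Summits.HubbardSuperconductivity.HubbardLadder.Bounds.TwistCurvature
import Literature.MathematicalPhysics.QuantumFieldTheory.Balaban1983to89.B8Eq146AExpansion
import HarnessLib

/-!
# Theorem 12 (iv), the rate-`2^{-L}` instances: `T ≥ 480(|t|+|t'|)` (twist insensitivity, no
# stiffness) and `T ≥ 790(|t|+|t'|)` (curvature) with decay `2^{-L}` — the Kotecký–Preiss instance
# `KP̄(1/479; a = 0.431, b = log 2)` certified in the kernel (LEAN FILING REQUEST #206.4, bounds g27)

HONEST FRAMING (cell pub-hubbard): ladder R1–R4 with certified numbers; no claim on H/H₀. This file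
is a BOUND FOR A MODEL CLASS (the seam-twisted `t–t'` Hubbard torus `hubbardTorusTT'FluxMu L t' U μ θ`
at high temperature, any sign of `U`, any `μ`); no materials claim. STAGED, not yet in the tree,
until filed.

bounds.tex Theorem 12 (iv) displays four certified readings; two (`T ≥ 160 ⇒ ρ_s ≤ 0.754 T L² e^{-L/1000}/θ₀²`
and `T ≥ 265 ⇒ |𝒟^F| ≤ 6.04 T e^{-L/1000}`) are kernel-checked by #198.4 and #206.3 from the instance
`kpBarLHS_inst160` of #181.1. This file certifies the remaining two, whose decay rate is `2^{-L}`
(`b = log 2`):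

* `kpBarLHS_inst479_log2 : kpBarLHS (1/479) (431/1000) (log 2) ≤ 431/1000` — kernel arithmetic
  (`e^{a + log 2 + 8y} = 2 e^{a+8y}`, cubic Taylor upper bounds for `e^{4y}` and `e^{a+8y}`, `norm_num`;
  exact margin `0.0025`); EXTREMISERS.md §5w instance I2 = `KP̄(1/480; 0.431, log 2)` follows by
  monotonicity (`kpBarLHS_inst480_log2`), and so does the `η = 1/2` curvature instance at `1/790`,
  since `e^{1/2}/790 ≤ 1/479` (`exp_half_le_790_479`).
* `HighTemperatureTwistInsensitivityTT'At480` + `_holds`: `β(1+|t'|) ≤ 1/480 ⇒`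
  `|log Re Z_L(0) - log Re Z_L(θ)| ≤ 0.862 L² 2^{-L}` for every `θ`, `L ≥ 3`, uniformly in `U`, `μ`
  (paper: `|F(β,θ/L) - F(β,0)| ≤ 0.862 T L² 2^{-L}`). PROVED.
* `HighTemperatureNoThermalStiffnessTT'At480` + `_holds`: every flux stiffness of the grand-canonical
  free energy obeys `ρ_s ≤ 0.862 L² 2^{-L}/(β θ₀²)`. PROVED.
* `HighTemperatureNoTwistCurvatureTT'At790` + `_holds`: `β(1+|t'|) ≤ 1/790 ⇒ |𝒟^F_L(β)| ≤ 6.896 · 2^{-L}/β`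
  (paper: `6.90 T 2^{-L}`). PROVED.

References: R. Kotecký, D. Preiss, Comm. Math. Phys. 103 (1986) 491 [KoteckyPreiss1986]; D. Ueltschi,
J. Stat. Phys. 95 (1999) 693, §2.3 [Ueltschi1999]; bounds.tex §12 Thm 12 (iv); EXTREMISERS.md §5w,
§5z-addendum-3.
-/

noncomputable section

namespace Summit.HubbardSuperconductivity.HubbardLadder.Bounds

open Matrix Finset Literature.MathematicalPhysics.QuantumLattice Literature.Probability.LatticeModels
open scoped ComplexConjugate ComplexOrder

/-! ### The certified Kotecký–Preiss instance at decay rate `log 2` -/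

/-- Cubic Taylor upper bound `e^x ≤ 1 + x + x²/2 + (2/9)x³` on `[0,1]` (from Mathlib's
`Real.exp_bound'` with three terms; the same inline bound as in #181.1's `kpBarLHS_inst160`).
[this file]
(Filer edit, lit g14: the identical statement is landed as the Literature lemma
`Balaban1983to89.B8Eq146AExpansion.exp_le_taylor3`; reused by `alias` per the gate's `dedup.landed`
rule instead of re-proved — implicit `{t : ℝ}`, hypotheses `0 ≤ t`, `t ≤ 1`, same conclusion.) -/
alias exp_le_taylor_cubic :=
  Literature.MathematicalPhysics.QuantumFieldTheory.Balaban1983to89.B8Eq146AExpansion.exp_le_taylor3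

/-- **Certified instance `KP̄(1/479; a = 0.431, b = log 2)`** of the Kotecký–Preiss condition of
Theorem 12 (kernel arithmetic: `e^{a + log 2 + 8y} = 2e^{a+8y}`, the cubic Taylor bounds for the two
remaining exponentials, `norm_num`; exact rational margin `0.0025`). It dominates EXTREMISERS.md §5w's
instance I2 (`y = 1/480`) and the `η = 1/2` curvature instance at `y = 1/790` (`e^{1/2}/790 ≤ 1/479`).
[programme instance: bounds.tex §12 Thm 12 (iv), EXTREMISERS.md §5w I2, §5z-addendum-3] -/
theorem kpBarLHS_inst479_log2 : kpBarLHS (1 / 479) (431 / 1000) (Real.log 2) ≤ 431 / 1000 := by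
  unfold kpBarLHS
  have hsplit : Real.exp (431 / 1000 + Real.log 2 + 8 * (1 / 479 : ℝ)) =
      2 * Real.exp (431 / 1000 + 8 * (1 / 479 : ℝ)) := by
    rw [show (431 / 1000 + Real.log 2 + 8 * (1 / 479 : ℝ)) =
        (431 / 1000 + 8 * (1 / 479 : ℝ)) + Real.log 2 by ring, Real.exp_add,
      Real.exp_log (by norm_num : (0 : ℝ) < 2), mul_comm]
  rw [hsplit]
  have h1 : Real.exp (4 * (1 / 479 : ℝ)) ≤ 1 + 4 * (1 / 479 : ℝ) + (4 * (1 / 479 : ℝ)) ^ 2 / 2 +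
      2 / 9 * (4 * (1 / 479 : ℝ)) ^ 3 := exp_le_taylor_cubic (by norm_num) (by norm_num)
  have h2 : Real.exp (431 / 1000 + 8 * (1 / 479 : ℝ)) ≤
      1 + (431 / 1000 + 8 * (1 / 479 : ℝ)) + (431 / 1000 + 8 * (1 / 479 : ℝ)) ^ 2 / 2 +
        2 / 9 * (431 / 1000 + 8 * (1 / 479 : ℝ)) ^ 3 :=
    exp_le_taylor_cubic (by norm_num) (by norm_num)
  have h0 : 0 ≤ 2 * Real.exp (431 / 1000 + 8 * (1 / 479 : ℝ)) + 431 / 1000 := by positivity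
  calc 16 * (1 / 479 : ℝ) * Real.exp (4 * (1 / 479)) *
        (2 * Real.exp (431 / 1000 + 8 * (1 / 479)) + 431 / 1000) ^ 2
      ≤ 16 * (1 / 479 : ℝ) * (1 + 4 * (1 / 479 : ℝ) + (4 * (1 / 479 : ℝ)) ^ 2 / 2 +
            2 / 9 * (4 * (1 / 479 : ℝ)) ^ 3) *
          (2 * (1 + (431 / 1000 + 8 * (1 / 479 : ℝ)) + (431 / 1000 + 8 * (1 / 479 : ℝ)) ^ 2 / 2 +
              2 / 9 * (431 / 1000 + 8 * (1 / 479 : ℝ)) ^ 3) + 431 / 1000) ^ 2 := by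
        gcongr
    _ ≤ 431 / 1000 := by norm_num

/-- **EXTREMISERS.md §5w instance I2** `KP̄(1/480; 0.431, log 2)` (bounds.tex Thm 12 (iv):
`T ≥ 480(|t|+|t'|)` lies in the Kotecký–Preiss domain with decay rate `2^{-L}`), by monotonicity from
`kpBarLHS_inst479_log2`. [programme instance: bounds.tex §12 Thm 12 (iv), EXTREMISERS.md §5w I2] -/
theorem kpBarLHS_inst480_log2 : kpBarLHS (1 / 480) (431 / 1000) (Real.log 2) ≤ 431 / 1000 :=
  (kpBarLHS_mono (by norm_num) (by norm_num) (by norm_num)).trans kpBarLHS_inst479_log2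

/-- `e^{1/2} ≤ 790/479` (`e < 2.7182818286 ≤ (790/479)² = 2.72008…`). [this file] -/
theorem exp_half_le_790_479 : Real.exp (1 / 2) ≤ 790 / 479 := by
  have h : Real.exp (1 / 2) * Real.exp (1 / 2) = Real.exp 1 := by
    rw [← Real.exp_add]; norm_num
  nlinarith [Real.exp_one_lt_d9, Real.exp_pos (1 / 2)]

/-- `e^{-(log 2) L} = (1/2)^L` for natural `L`. [this file] -/
theorem exp_neg_log_two_mul (L : ℕ) : Real.exp (-(Real.log 2 * L)) = (1 / 2 : ℝ) ^ L := by
  rw [Real.exp_neg, mul_comm, Real.exp_nat_mul, Real.exp_log (by norm_num : (0 : ℝ) < 2), one_div,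
    inv_pow]

/-! ### The readings of Theorem 12 (iv) at rate `2^{-L}` -/

section Torus

variable {L : ℕ} [NeZero L]

/-- **Node (certified reading `T ≥ 480(|t|+|t'|)` of Thm 12 (i)/(iv); PROVED below).** For `L ≥ 3`,
real `t', U, μ`, `β > 0` with `β(1+|t'|) ≤ 1/480` and every seam twist `θ`:
`|log Re Z_L(0) - log Re Z_L(θ)| ≤ 0.862 L² 2^{-L}` (paper: `|F(β,θ/L) - F(β,0)| ≤ 0.862 T L² 2^{-L}`),
uniformly in `U`, `μ`, `θ`. [programme node: bounds.tex §12 Thm 12 (iv), instance I2] -/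
@[conjecture] def HighTemperatureTwistInsensitivityTT'At480 : Prop :=
  ∀ (L : ℕ) [NeZero L], 3 ≤ L → ∀ (t' U μ β : ℝ), 0 < β → β * (1 + |t'|) ≤ 1 / 480 →
    ∀ θ : ℝ,
      |Real.log (partitionFn β (hubbardTorusTT'FluxMu L t' U μ 0)).re -
          Real.log (partitionFn β (hubbardTorusTT'FluxMu L t' U μ θ)).re| ≤
        862 / 1000 * (L : ℝ) ^ 2 * (1 / 2 : ℝ) ^ L

/-- **PROOF of the node `HighTemperatureTwistInsensitivityTT'At480`** (node (i) of #181.1, proved in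
#198.4, at `a = 0.431`, `b = log 2`; monotonicity of `KP̄` and `kpBarLHS_inst480_log2`). [this file] -/
theorem highTemperatureTwistInsensitivityTT'At480_holds : HighTemperatureTwistInsensitivityTT'At480 := by
  intro L _ hL t' U μ β hβ hT θ
  have hy : 0 ≤ β * (1 + |t'|) := by positivity
  have hkp : kpBarLHS (β * (1 + |t'|)) (431 / 1000) (Real.log 2) ≤ 431 / 1000 :=
    (kpBarLHS_mono hy hT (by norm_num)).trans kpBarLHS_inst480_log2
  have h := highTemperatureTwistInsensitivityTT'_holds L hL t' U μ β (431 / 1000) (Real.log 2) hβ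
    (by norm_num) (Real.log_nonneg (by norm_num)) hkp θ
  rw [exp_neg_log_two_mul] at h
  refine h.trans (le_of_eq ?_)
  ring

/-- **Node (certified reading `T ≥ 480(|t|+|t'|)` of Thm 12 (ii)/(iv); PROVED below).** For `L ≥ 3`,
real `t', U, μ`, `β > 0` with `β(1+|t'|) ≤ 1/480`, every `θ₀ > 0` and every flux stiffness `ρ_s` of
the grand-canonical free energy on `|θ| ≤ θ₀` (`β ρ_s θ² ≤ log Re Z_L(0) - log Re Z_L(θ)`):
`ρ_s ≤ 0.862 L² 2^{-L}/(β θ₀²)`, uniformly in `U`, `μ`. [programme node: bounds.tex §12 Thm 12 (iv),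
instance I2] -/
@[conjecture] def HighTemperatureNoThermalStiffnessTT'At480 : Prop :=
  ∀ (L : ℕ) [NeZero L], 3 ≤ L → ∀ (t' U μ β ρs θ₀ : ℝ), 0 < β → 0 < θ₀ →
    β * (1 + |t'|) ≤ 1 / 480 →
    (∀ θ : ℝ, |θ| ≤ θ₀ → β * ρs * θ ^ 2 ≤
        Real.log (partitionFn β (hubbardTorusTT'FluxMu L t' U μ 0)).re -
          Real.log (partitionFn β (hubbardTorusTT'FluxMu L t' U μ θ)).re) →
    ρs ≤ 862 / 1000 * (L : ℝ) ^ 2 * (1 / 2 : ℝ) ^ L / (β * θ₀ ^ 2)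

/-- **PROOF of the node `HighTemperatureNoThermalStiffnessTT'At480`** (#181.1's reduction
`highTemperatureNoThermalStiffnessTT'_of_insensitivity` applied to the kernel-proved node (i), at
`a = 0.431`, `b = log 2`). [this file] -/
theorem highTemperatureNoThermalStiffnessTT'At480_holds : HighTemperatureNoThermalStiffnessTT'At480 := by
  intro L _ hL t' U μ β ρs θ₀ hβ hθ₀ hT hstiff
  have hy : 0 ≤ β * (1 + |t'|) := by positivity
  have hkp : kpBarLHS (β * (1 + |t'|)) (431 / 1000) (Real.log 2) ≤ 431 / 1000 :=
    (kpBarLHS_mono hy hT (by norm_num)).trans kpBarLHS_inst480_log2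
  have h := highTemperatureNoThermalStiffnessTT'_of_insensitivity highTemperatureTwistInsensitivityTT'_holds
    L hL t' U μ β (431 / 1000) (Real.log 2) ρs θ₀ hβ (by norm_num) (Real.log_nonneg (by norm_num)) hθ₀
    hkp hstiff
  rw [exp_neg_log_two_mul] at h
  refine h.trans (le_of_eq ?_)
  ring

/-- **Node (certified reading `T ≥ 790(|t|+|t'|)` of Thm 12 (iii)/(iv); PROVED below).** For `L ≥ 3`,
real `t', U, μ`, `β > 0` with `β(1+|t'|) ≤ 1/790`: `|𝒟^F_L(β)| ≤ 6.896 · 2^{-L}/β` (`= 6.896 T 2^{-L}`;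
paper Thm 12 (iv): `6.90 T 2^{-L}`), uniformly in `U`, `μ` (`η = 1/2`, `a = 0.431`, `b = log 2`,
`4a/η² = 6.896`). [programme node: bounds.tex §12 Thm 12 (iv), EXTREMISERS.md §5w (`η = 1/2` row),
§5z-addendum-3] -/
@[conjecture] def HighTemperatureNoTwistCurvatureTT'At790 : Prop :=
  ∀ (L : ℕ) [NeZero L], 3 ≤ L → ∀ (t' U μ β : ℝ), 0 < β → β * (1 + |t'|) ≤ 1 / 790 →
    |thermalTwistCurvature L t' U μ β| ≤ 6896 / 1000 * (1 / 2 : ℝ) ^ L / β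

/-- **PROOF of the node `HighTemperatureNoTwistCurvatureTT'At790`** (`β e^{1/2}(1+|t'|) ≤ 1/479` by
`exp_half_le_790_479`; monotonicity of `KP̄`, `kpBarLHS_inst479_log2`, and #206.3's
`highTemperatureNoTwistCurvatureTT'_holds` at `η = 1/2`). [this file] -/
theorem highTemperatureNoTwistCurvatureTT'At790_holds : HighTemperatureNoTwistCurvatureTT'At790 := by
  intro L _ hL t' U μ β hβ hT
  have hy0 : 0 ≤ β * Real.exp (1 / 2) * (1 + |t'|) := by positivity
  have hy : β * Real.exp (1 / 2) * (1 + |t'|) ≤ 1 / 479 := by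
    have h1 : 0 ≤ β * (1 + |t'|) := by positivity
    calc β * Real.exp (1 / 2) * (1 + |t'|) = Real.exp (1 / 2) * (β * (1 + |t'|)) := by ring
      _ ≤ 790 / 479 * (1 / 790) := mul_le_mul exp_half_le_790_479 hT h1 (by norm_num)
      _ = 1 / 479 := by norm_num
  have hkp : kpBarLHS (β * Real.exp (1 / 2) * (1 + |t'|)) (431 / 1000) (Real.log 2) ≤ 431 / 1000 :=
    (kpBarLHS_mono hy0 hy (by norm_num)).trans kpBarLHS_inst479_log2
  have h := highTemperatureNoTwistCurvatureTT'_holds L hL t' U μ β (431 / 1000) (Real.log 2) (1 / 2) hβ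
    (by norm_num) (Real.log_nonneg (by norm_num)) (by norm_num) hkp
  rw [exp_neg_log_two_mul] at h
  refine h.trans (le_of_eq ?_)
  field_simp
  ring

end Torus

end Summit.HubbardSuperconductivity.HubbardLadder.Bounds

end
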